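import Literature.Probability.Percolation.ArmEventsStructure
import Literature.Probability.Percolation.WernerPivotalEstimates
import HarnessLib

/-!
# The alternating four-arm event (cluster form) and its probability

Topic `Literature/Probability/Percolation`; family `crit-perc`, statement **crit-perc.S16**
(`Literature.Probability.Percolation.triTheta_exponent`). DEFINITIONS with their elementary API;
no named fact.

The tree's arm event `armEvent κ r R` (`ArmEvents.lean`; Smirnov–Werner 2001, §3) does not
prescribe the cyclic order of the colours around the annulus, so that `armEvent ![T,F,T,F]`
(and with it `critFourArmProb`, `fourArmProbAt`) is the probability of two open and two closed
disjoint crossings of `Λ_R ∖ Λ_r` in alternating OR in adjacent order, whereas the four-arm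
events of Kesten (1987, §1, (1.12): "four paths … alternately occupied and vacant"), Nolin (2008,
§4.1: `A_{j,σ}(n, N)` with `σ = BWBW` "in counterclockwise order") and Werner (2009, Lecture 6:
`π̂_p`) are the ALTERNATING ones — the arms produced by a pivotal site. The near-critical arm
calculus (separation, quasi-multiplicativity, stability below `L(p)`) is developed in the
literature for one colour sequence at a time; the comparison of two different arrangements is a
separate statement (colour switching at `p = 1/2`, Nolin 2008, §5.1; Aizenman–Duplantier–Aharony
1999). This file introduces the alternating event in a form that avoids planar topology:

* `altFourArm r R` — four pairwise vertex-disjoint arms of colours open/closed/open/closed across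
  `Λ_R ∖ Λ_r` (exactly the data of `armEvent ![true,false,true,false] r R`) such that **the two
  open arms are not joined by an open path of the closed annulus `{r ≤ |·| ≤ R}` and the two
  closed arms are not joined by a closed path of it** ("cluster form" of alternation: the two
  open arms lie in distinct open clusters of the annulus and the two closed arms in distinct
  closed clusters; for arms in alternating cyclic order this holds since an open path between the
  open arms would have to cross a closed arm, and conversely two open crossings in distinct open
  clusters are separated on both sides by closed crossings, Kesten 1982, §2.2–2.3). The cluster
  form is stable under truncation of the radii and under rerouting of an arm inside its own
  cluster (Kesten's fences), which is all the arm calculus uses.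
* `altFourArmProbAt t r R = P_t(altFourArm r R)` — Werner's `π̂_p(r, R)` (Lecture 6, §4) in the
  alternating form.
* API: `altFourArm_subset_armEvent` (`π̂^alt ≤ π̂`), `altFourArm_anti` / `altFourArm_mono_left`
  (monotonicity in the two radii, by truncation as in `armEvent_mono_holds`,
  `armEvent_mono_left`), `determinedBy_altFourArm`, `measurableSet_altFourArm`,
  `compl_preimage_altFourArm` (colour flip = cyclic relabelling), `altFourArmProbAt_symm`
  (`π̂^alt_{1-t} = π̂^alt_t`), and the numerical bounds.

## References

* H. Kesten, Scaling relations for 2D-percolation, *Comm. Math. Phys.* 109 (1987), §1, (1.12)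
  (four alternating arms) [KestenScalingCMP1987].
* P. Nolin, Near-critical percolation in two dimensions, *Electron. J. Probab.* 13 (2008), §4.1
  (the events `A_{j,σ}(n,N)`, colour sequences in cyclic order), §5.1 (colour switching)
  (arXiv 0711.4948) [Nolin2008].
* W. Werner, *Lectures on two-dimensional critical percolation*, PCMI 2009, Lecture 6, §4
  (`π̂_p(r₁, r₂)`) [WernerPCMI2009].
* S. Smirnov, W. Werner, Critical exponents for two-dimensional percolation, *Math. Res. Lett.* 8
  (2001), §3 [SmirnovWernerMRL2001].
* H. Kesten, *Percolation theory for mathematicians* (1982), §2.2–2.3 [KestenPTM1982].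

Tree: `armEvent`, `IsColouredPath` (`ArmEvents.lean`), `triWalkTruncAt` and its API,
`triAnnulus`, `mem_triAnnulus_of_arm`, `armEvent_mono_holds`, `armEvent_mono_left`
(`ArmEventsProofs.lean`), `determinedBy_iff`, `DeterminedBy.measurableSet_of_finset`
(`PercolationEvents.lean`), `isColouredPath_compl_iff` (`ArmEventsStructure.lean`),
`fourArmProbAt` (`WernerPivotalEstimates.lean`), `sitePercolation_real_preimage_compl`
(`TriHexLemma.lean`), `PathIn` (`SitePaths.lean`). Mathlib: `SimpleGraph.Walk`, `Fin` arithmetic.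
-/

noncomputable section

open Set MeasureTheory
open scoped unitInterval

namespace Literature.Probability.Percolation

open LatticeModels

/-! ### The event -/

/-- The closed hexagonal annulus `{r ≤ |v|_𝕋 ≤ R}` as a set of sites (the coercion of
`triAnnulus r R`), the region of the arms of `armEvent κ r R`. [cite: SmirnovWernerMRL2001, §3] -/
abbrev triAnn (r R : ℕ) : Set (Site 2) := ↑(triAnnulus r R)

/-- Membership in `triAnn`. [cite: SmirnovWernerMRL2001, §3] -/
theorem mem_triAnn {r R : ℕ} {v : Site 2} : v ∈ triAnn r R ↔ (r : ℤ) ≤ triNorm v ∧ triNorm v ≤ R := by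
  rw [triAnn, Finset.mem_coe, mem_triAnnulus]

/-- **The alternating four-arm event, cluster form.** Four pairwise vertex-disjoint self-avoiding
arms `w 0, …, w 3` across the annulus `Λ_R ∖ Λ_r` of `𝕋`, from `∂Λ_r` to `∂Λ_R`, of colours
open, closed, open, closed (the data of `armEvent ![true, false, true, false] r R`), such that no
open path of the closed annulus `{r ≤ |·| ≤ R}` joins a site of `w 0` to a site of `w 2` and no
closed path of it joins a site of `w 1` to a site of `w 3`: the two open arms lie in distinct
open clusters of the annulus, the two closed arms in distinct closed clusters. This is the form in
which "four arms of alternating colours" (Kesten 1987, (1.12); Nolin 2008, §4.1, `σ = BWBW`;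
Werner 2009, Lecture 6, `π̂`) is used by the arm calculus. [cite: KestenScalingCMP1987, §1 (1.12)] [cite: Nolin2008, §4.1 (arXiv 0711.4948, §4.1)] -/
def altFourArm (r R : ℕ) : Set (SiteConfig (Site 2)) :=
  {ω | ∃ (x y : Fin 4 → Site 2) (w : ∀ j, triGraph.Walk (x j) (y j)),
    (∀ j, x j ∈ triSphere r ∧ y j ∈ triSphere R ∧ (w j).IsPath ∧
      (∀ v ∈ (w j).support, v ∈ (↑(triBall R) : Set (Site 2)) \ ↑(triBall r) ∨ v ∈ triSphere r) ∧
      IsColouredPath ω (![true, false, true, false] j) (w j)) ∧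
    (Pairwise fun i j => Disjoint (w i).support.toFinset (w j).support.toFinset) ∧
    (∀ u ∈ (w 0).support, ∀ v ∈ (w 2).support, ¬ PathIn triGraph (triAnn r R ∩ ω) u v) ∧
    (∀ u ∈ (w 1).support, ∀ v ∈ (w 3).support, ¬ PathIn triGraph (triAnn r R \ ω) u v)}

/-- **Werner's `π̂_p(r, R)` in the alternating form**: the `P_t`-probability of `altFourArm r R`.
[cite: WernerPCMI2009, Lecture 6, §4 (π̂_p(r₁, r₂))] -/
def altFourArmProbAt (t : unitInterval) (r R : ℕ) : ℝ :=
  (triSitePercolation t).real (altFourArm r R)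

/-- The alternating four-arm event is contained in the order-free one. [cite: Nolin2008, §4.1] -/
theorem altFourArm_subset_armEvent (r R : ℕ) :
    altFourArm r R ⊆ armEvent ![true, false, true, false] r R := by
  rintro ω ⟨x, y, w, hw, hdisj, -, -⟩
  exact ⟨x, y, w, hw, hdisj⟩

/-- `π̂^alt_t(r, R) ≤ π̂_t(r, R)`. [cite: WernerPCMI2009, Lecture 6, §4] -/
theorem altFourArmProbAt_le_fourArmProbAt (t : unitInterval) (r R : ℕ) :
    altFourArmProbAt t r R ≤ fourArmProbAt t r R :=
  measureReal_mono (altFourArm_subset_armEvent r R) (measure_ne_top _ _)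

/-- `0 ≤ π̂^alt_t(r, R)`. [folklore] -/
theorem altFourArmProbAt_nonneg (t : unitInterval) (r R : ℕ) : 0 ≤ altFourArmProbAt t r R :=
  measureReal_nonneg

/-- `π̂^alt_t(r, R) ≤ 1`. [folklore] -/
theorem altFourArmProbAt_le_one (t : unitInterval) (r R : ℕ) : altFourArmProbAt t r R ≤ 1 :=
  measureReal_le_one

/-! ### Monotonicity in the radii -/

/-- The annuli are nested in the outer radius. [folklore] -/
theorem triAnn_mono_right (r : ℕ) {R R' : ℕ} (h : R ≤ R') : triAnn r R ⊆ triAnn r R' := by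
  intro v hv
  rw [mem_triAnn] at hv ⊢
  exact ⟨hv.1, by omega⟩

/-- The annuli are nested in the inner radius. [folklore] -/
theorem triAnn_anti_left {r r' : ℕ} (h : r ≤ r') (R : ℕ) : triAnn r' R ⊆ triAnn r R := by
  intro v hv
  rw [mem_triAnn] at hv ⊢
  exact ⟨by omega, hv.2⟩

/-- **Enlarging the outer radius shrinks the alternating event** (`r ≤ R ≤ R'`): truncate each arm
at its first visit of `∂Λ_R` (`triWalkTruncAt`, as in `armEvent_mono_holds`); the truncated arms
are sub-walks, and an open (closed) path of the smaller annulus between them is one of the larger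
annulus between the original arms. [cite: SmirnovWernerMRL2001, §3] [cite: Nolin2008, §4.1] -/
theorem altFourArm_anti (r : ℕ) {R R' : ℕ} (hr : r ≤ R) (hR : R ≤ R') :
    altFourArm r R' ⊆ altFourArm r R := by
  intro ω hω
  obtain ⟨x, y, w, hw, hdisj, hoo, hcc⟩ := hω
  refine ⟨x, fun j => (triWalkTruncAt R (w j)).1, fun j => (triWalkTruncAt R (w j)).2,
    fun j => ?_, ?_, ?_, ?_⟩
  · obtain ⟨hx, hy, hpath, hsupp, hcol⟩ := hw j
    have hxn : triNorm (x j) = r := mem_triSphere_iff.1 hx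
    have hyn : triNorm (y j) = R' := mem_triSphere_iff.1 hy
    obtain ⟨hend, hle⟩ := triWalkTruncAt_spec_up (R : ℤ) (w j) (by omega) (by omega)
    refine ⟨hx, mem_triSphere_iff.2 hend, isPath_triWalkTruncAt _ hpath, fun v hv => ?_,
      fun v hv => hcol v (support_triWalkTruncAt_subset _ _ hv)⟩
    have hvR : triNorm v ≤ R := hle v hv
    rcases hsupp v (support_triWalkTruncAt_subset _ _ hv) with hv' | hv'
    · left
      simp only [Set.mem_sdiff, Finset.mem_coe, mem_triBall_iff] at hv' ⊢
      exact ⟨hvR, hv'.2⟩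
    · exact Or.inr hv'
  · intro i j hij
    refine Finset.disjoint_left.2 fun v hvi hvj => ?_
    exact Finset.disjoint_left.1 (hdisj hij)
      (List.mem_toFinset.2 (support_triWalkTruncAt_subset _ _ (List.mem_toFinset.1 hvi)))
      (List.mem_toFinset.2 (support_triWalkTruncAt_subset _ _ (List.mem_toFinset.1 hvj)))
  · intro u hu v hv hp
    exact hoo u (support_triWalkTruncAt_subset _ _ hu) v (support_triWalkTruncAt_subset _ _ hv)
      (hp.mono (Set.inter_subset_inter_left _ (triAnn_mono_right r hR)))
  · intro u hu v hv hp
    exact hcc u (support_triWalkTruncAt_subset _ _ hu) v (support_triWalkTruncAt_subset _ _ hv)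
      (hp.mono (Set.sdiff_subset_sdiff_left (triAnn_mono_right r hR)))

/-- **Enlarging the inner radius enlarges the alternating event** (`r ≤ r' ≤ R`): keep of each
arm its final segment after the last visit of `∂Λ_{r'}` (as in `armEvent_mono_left`); paths of
the smaller annulus between the new arms are paths of the larger annulus between the old ones.
[cite: SmirnovWernerMRL2001, §3] [cite: Nolin2008, §4.1] -/
theorem altFourArm_mono_left {r r' R : ℕ} (hr : r ≤ r') (hR : r' ≤ R) :
    altFourArm r R ⊆ altFourArm r' R := by
  classical
  intro ω hω
  obtain ⟨x, y, w, hw, hdisj, hoo, hcc⟩ := hω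
  have hsub : ∀ l, ∀ v, v ∈ (triWalkTruncAt (r' : ℤ) (w l).reverse).2.reverse.support →
      v ∈ (w l).support := by
    intro l v hv
    rw [SimpleGraph.Walk.support_reverse, List.mem_reverse] at hv
    have := support_triWalkTruncAt_subset _ _ hv
    rwa [SimpleGraph.Walk.support_reverse, List.mem_reverse] at this
  refine ⟨fun j => (triWalkTruncAt r' (w j).reverse).1, y,
    fun j => (triWalkTruncAt r' (w j).reverse).2.reverse, fun j => ?_, ?_, ?_, ?_⟩
  · obtain ⟨hx, hy, hpath, hsupp, hcol⟩ := hw j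
    have hxn : triNorm (x j) = r := mem_triSphere_iff.1 hx
    have hyn : triNorm (y j) = R := mem_triSphere_iff.1 hy
    obtain ⟨hend, hge⟩ := triWalkTruncAt_spec_down (r' : ℤ) (w j).reverse (by omega) (by omega)
    refine ⟨mem_triSphere_iff.2 hend, hy, ?_, fun v hv => ?_, fun v hv => hcol v (hsub j v hv)⟩
    · exact (isPath_triWalkTruncAt _ hpath.reverse).reverse
    · have hv' : (r' : ℤ) ≤ triNorm v := by
        apply hge
        rw [SimpleGraph.Walk.support_reverse, List.mem_reverse] at hv
        exact hv
      have hvR : triNorm v ≤ R :=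
        (mem_triAnnulus.1 (mem_triAnnulus_of_arm (hr.trans hR) (hsupp v (hsub j v hv)))).2
      rcases eq_or_lt_of_le hv' with h | h
      · right
        rw [mem_triSphere_iff, ← h]
      · left
        simp only [Set.mem_sdiff, Finset.mem_coe, mem_triBall_iff, not_le]
        exact ⟨hvR, h⟩
  · intro i j hij
    refine Finset.disjoint_left.2 fun v hvi hvj => ?_
    exact Finset.disjoint_left.1 (hdisj hij)
      (List.mem_toFinset.2 (hsub i v (List.mem_toFinset.1 hvi)))
      (List.mem_toFinset.2 (hsub j v (List.mem_toFinset.1 hvj)))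
  · intro u hu v hv hp
    exact hoo u (hsub 0 u hu) v (hsub 2 v hv)
      (hp.mono (Set.inter_subset_inter_left _ (triAnn_anti_left hr R)))
  · intro u hu v hv hp
    exact hcc u (hsub 1 u hu) v (hsub 3 v hv)
      (hp.mono (Set.sdiff_subset_sdiff_left (triAnn_anti_left hr R)))

/-- `π̂^alt_t` is antitone in the outer radius. [cite: Nolin2008, §4.1] -/
theorem altFourArmProbAt_anti (t : unitInterval) (r : ℕ) {R R' : ℕ} (hr : r ≤ R) (hR : R ≤ R') :
    altFourArmProbAt t r R' ≤ altFourArmProbAt t r R :=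
  measureReal_mono (altFourArm_anti r hr hR) (measure_ne_top _ _)

/-- `π̂^alt_t` is monotone in the inner radius. [cite: Nolin2008, §4.1] -/
theorem altFourArmProbAt_mono_left (t : unitInterval) {r r' R : ℕ} (hr : r ≤ r') (hR : r' ≤ R) :
    altFourArmProbAt t r R ≤ altFourArmProbAt t r' R :=
  measureReal_mono (altFourArm_mono_left hr hR) (measure_ne_top _ _)

/-! ### Locality and measurability -/

/-- Configurations agreeing on the annulus have the same open part of it. [folklore] -/
theorem triAnn_inter_eq_of_agree {r R : ℕ} {ω ω' : SiteConfig (Site 2)}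
    (h : ∀ v ∈ triAnnulus r R, (v ∈ ω ↔ v ∈ ω')) : triAnn r R ∩ ω = triAnn r R ∩ ω' := by
  ext v
  simp only [Set.mem_inter_iff, triAnn, Finset.mem_coe]
  exact ⟨fun ⟨hv, hω⟩ => ⟨hv, (h v hv).1 hω⟩, fun ⟨hv, hω⟩ => ⟨hv, (h v hv).2 hω⟩⟩

/-- Configurations agreeing on the annulus have the same closed part of it. [folklore] -/
theorem triAnn_diff_eq_of_agree {r R : ℕ} {ω ω' : SiteConfig (Site 2)}
    (h : ∀ v ∈ triAnnulus r R, (v ∈ ω ↔ v ∈ ω')) : triAnn r R \ ω = triAnn r R \ ω' := by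
  ext v
  simp only [Set.mem_sdiff, triAnn, Finset.mem_coe]
  exact ⟨fun ⟨hv, hω⟩ => ⟨hv, fun h' => hω ((h v hv).2 h')⟩,
    fun ⟨hv, hω⟩ => ⟨hv, fun h' => hω ((h v hv).1 h')⟩⟩

/-- **The alternating four-arm event is determined by the sites of the annulus** `triAnnulus r R`
(the arms lie in it, `mem_triAnnulus_of_arm`, and the two separation clauses only mention paths of
it). [cite: SmirnovWernerMRL2001, §3] -/
theorem altFourArm_determined {r R : ℕ} (hrR : r ≤ R) (ω ω' : SiteConfig (Site 2))
    (h : ∀ v ∈ triAnnulus r R, (v ∈ ω ↔ v ∈ ω')) : ω ∈ altFourArm r R ↔ ω' ∈ altFourArm r R := by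
  have hi := triAnn_inter_eq_of_agree h
  have hd := triAnn_diff_eq_of_agree h
  constructor
  · rintro ⟨x, y, w, hw, hdisj, hoo, hcc⟩
    refine ⟨x, y, w, fun j => ?_, hdisj, ?_, ?_⟩
    · obtain ⟨hx, hy, hpath, hsupp, hcol⟩ := hw j
      exact ⟨hx, hy, hpath, hsupp, fun v hv =>
        (h v (mem_triAnnulus_of_arm hrR (hsupp v hv))).symm.trans (hcol v hv)⟩
    · intro u hu v hv; rw [← hi]; exact hoo u hu v hv
    · intro u hu v hv; rw [← hd]; exact hcc u hu v hv
  · rintro ⟨x, y, w, hw, hdisj, hoo, hcc⟩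
    refine ⟨x, y, w, fun j => ?_, hdisj, ?_, ?_⟩
    · obtain ⟨hx, hy, hpath, hsupp, hcol⟩ := hw j
      exact ⟨hx, hy, hpath, hsupp, fun v hv =>
        (h v (mem_triAnnulus_of_arm hrR (hsupp v hv))).trans (hcol v hv)⟩
    · intro u hu v hv; rw [hi]; exact hoo u hu v hv
    · intro u hu v hv; rw [hd]; exact hcc u hu v hv

/-- `DeterminedBy` form of `altFourArm_determined`. [cite: SmirnovWernerMRL2001, §3] -/
theorem determinedBy_altFourArm {r R : ℕ} (hrR : r ≤ R) :
    DeterminedBy (altFourArm r R) ↑(triAnnulus r R) := by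
  rw [determinedBy_iff]
  intro ω ω' h
  refine altFourArm_determined hrR ω ω' fun v hv => ?_
  have hv' : v ∈ (↑(triAnnulus r R) : Set (Site 2)) := Finset.mem_coe.2 hv
  have key := Set.ext_iff.1 h v
  exact ⟨fun hω => (key.1 ⟨hω, hv'⟩).1, fun hω' => (key.2 ⟨hω', hv'⟩).1⟩

/-- The alternating four-arm event is measurable. [cite: SmirnovWernerMRL2001, §3] -/
theorem measurableSet_altFourArm {r R : ℕ} (hrR : r ≤ R) : MeasurableSet (altFourArm r R) :=
  (determinedBy_altFourArm hrR).measurableSet_of_finset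

/-! ### Colour flip -/

/-- The colour sequence `TFTF` read one step further is its negation. [folklore] -/
theorem vecTFTF_succ (j : Fin 4) :
    (![true, false, true, false] : Fin 4 → Bool) (j + 1) = !(![true, false, true, false] : Fin 4 → Bool) j := by
  fin_cases j <;> rfl

/-- **Colour flip = cyclic relabelling.** Complementing the configuration maps the alternating
four-arm event to itself: the arms `w (j+1)` of `ωᶜ`, read as arms `j ↦ w (j + 1)`, have the
colours `TFTF` in `ω`, and the two separation clauses are exchanged. [cite: SmirnovWernerMRL2001, Rem. 2] -/
theorem compl_mem_altFourArm {r R : ℕ} {ω : SiteConfig (Site 2)} (hω : ω ∈ altFourArm r R) :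
    ωᶜ ∈ altFourArm r R := by
  obtain ⟨x, y, w, hw, hdisj, hoo, hcc⟩ := hω
  refine ⟨fun j => x (j + 1), fun j => y (j + 1), fun j => w (j + 1), fun j => ?_, ?_, ?_, ?_⟩
  · obtain ⟨hx, hy, hpath, hsupp, hcol⟩ := hw (j + 1)
    refine ⟨hx, hy, hpath, hsupp, ?_⟩
    rw [isColouredPath_compl_iff, ← vecTFTF_succ]
    exact hcol
  · intro i j hij
    exact hdisj fun h => hij (by simpa using h)
  · -- open arms of `ωᶜ` are the closed arms `w 1`, `w 3` of `ω`
    intro u hu v hv hp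
    refine hcc u hu v hv (hp.mono fun z hz => ?_)
    exact ⟨hz.1, hz.2⟩
  · -- closed arms of `ωᶜ` are the open arms `w 2`, `w 0` of `ω`
    intro u hu v hv hp
    refine hoo v hv u hu ((hp.mono fun z hz => ?_).symm)
    simp only [Set.mem_sdiff, Set.mem_compl_iff, not_not] at hz
    exact ⟨hz.1, hz.2⟩

/-- `compl ⁻¹' altFourArm r R = altFourArm r R`. [cite: SmirnovWernerMRL2001, Rem. 2] -/
theorem compl_preimage_altFourArm (r R : ℕ) : compl ⁻¹' altFourArm r R = altFourArm r R := by
  ext ω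
  refine ⟨fun h => ?_, fun h => compl_mem_altFourArm h⟩
  have := compl_mem_altFourArm (ω := ωᶜ) h
  rwa [compl_compl] at this

/-- **`π̂^alt_{1-t}(r, R) = π̂^alt_t(r, R)`**: colour exchange maps `P_t` to `P_{1-t}`
(`sitePercolation_real_preimage_compl`) and the alternating event to itself. [cite: SmirnovWernerMRL2001, Rem. 2] [cite: Nolin2008, §2.1 (P̂ between P_p and P_{1-p})] -/
theorem altFourArmProbAt_symm (t : unitInterval) (r R : ℕ) :
    altFourArmProbAt (σ t) r R = altFourArmProbAt t r R := by
  rw [altFourArmProbAt, altFourArmProbAt, triSitePercolation, triSitePercolation,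
    ← sitePercolation_real_preimage_compl t (altFourArm r R), compl_preimage_altFourArm]

end Literature.Probability.Percolation

end
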